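import Summits.AtomisticToContinuum.Crystallization.Theorems.OverbindingBudgetAffineRunCutAxial
import Literature.MathematicalPhysics.StatisticalMechanics.HcpFccLatticeSumsKernelA4

/-!
# `OverbindingBudget` / crux `RobustDefectLimitWindows` (stmt-AtomisticToContinuum-31280) — «RunCut»: the two offset-coset box-sum enclosures
of the chirality remainder

Support file (lens-4 g87, hand-in 3; memo `g86/memo/SW-G1.md` §9.11, `g87/memo/SW-CHI.md`).  The summed chirality remainder
`…RunCutChiralityRemainder.coset_remainder_le` is charged against the two offset-coset inverse-power sums at the ADJACENT layer distance
(`k = 1`, `c² = 2/3`): `J₁⁽³⁾(2/3) = layerSum 1 3 (2/3) = Σ_{(i,j)} (Q₁(i,j) + 2/3)⁻³ ≈ 3.70322` and `J₁⁽⁶⁾(2/3) = layerSum 1 6 (2/3) ≈ 3.05562`.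
THIS FILE encloses both from two kernel-decided box floor sums (`boxFloorSum 2 3 1 1 40 n 10¹⁸`, the evaluator of
`Literature/…/HcpFccLatticeSums`, sound by `boxFloorSum_sound_le/_ge`) and the crude box-complement tail `tsum_compl_box_le` (box `40`:
tail `≤ 12·(1602/3)⁻² < 4.3·10⁻⁵` for `n = 3`, `< 10⁻¹²` for `n = 6`):
  ★ `layerSum_one_three_mem : 3.7032 ≤ J₁⁽³⁾(2/3) ≤ 3.7033`,  ★ `layerSum_one_six_mem : 3.0556 ≤ J₁⁽⁶⁾(2/3) ≤ 3.0557`.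
Values reproduced by exact integer arithmetic in `g87/numerics/coset_kernel.py` (box parts `3.703216287…`, `3.055622334…`).
[this file: 0 definitions, 4 theorems (2 `decide +kernel`); standard axioms]
-/

namespace Summit.AtomisticToContinuum.Crystallization.Theorems.OverbindingBudgetAffineRunCutChiralityKernel

open Literature.MathematicalPhysics.StatisticalMechanics.StackingSums

-- (landing lane, hand-2 g41: the kernel sum `boxFloorSum_3_1_1 : boxFloorSum 2 3 1 1 40 3 (10 ^ 18) = 5079857732293046` is ALREADY in the tree as
-- `Literature.MathematicalPhysics.StatisticalMechanics.StackingSums.boxFloorSum_3_1_1` (…HcpFccLatticeSumsKernelA4); the local copy was removed on the gate's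
-- `dedup.landed` and the Literature theorem is used through the `open` above.)

/-- `boxFloorSum 2 3 1 1 40 6 10^18 = 5749692504867` (offset pattern, layer `1`, exponent `6`, box `40`). [folklore · kernel] -/
theorem boxFloorSum_6_1_1 : boxFloorSum 2 3 1 1 40 6 (10 ^ 18) = 5749692504867 := by
  decide +kernel

/-- ★ **`3.7032 ≤ J₁⁽³⁾(2/3) ≤ 3.7033`** — the offset-coset sum `Σ (Q₁ + 2/3)⁻³` (box `40` kernel floor sum + crude tail `< 4.3·10⁻⁵`).
[this file · kind: proof] -/
theorem layerSum_one_three_mem : 3.7032 ≤ layerSum 1 3 (2 / 3) ∧ layerSum 1 3 (2 / 3) ≤ 3.7033 := by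
  have h1 := boxFloorSum_sound_le (p := 2) (q := 3) (δ := 1) (by norm_num) (by norm_num) le_rfl
    1 40 3 (M := 10 ^ 18) (by norm_num)
  have h1' := boxFloorSum_sound_ge (p := 2) (q := 3) (δ := 1) (by norm_num) (by norm_num) le_rfl
    (k := 1) 40 (n := 3) (by norm_num) (Or.inl (by norm_num)) (M := 10 ^ 18) (by norm_num)
  rw [boxFloorSum_3_1_1] at h1 h1'
  have lo := sum_box_le_layerSum (δ := 1) le_rfl (s := 2 / 3) (by norm_num) (n := 3) (by norm_num) 40
  have hi := layerSum_le_box_add_tail (δ := 1) le_rfl (s := 2 / 3) (by norm_num) (d := 2) (by norm_num) (R := 40)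
    (by norm_num)
  norm_num at h1 h1' lo hi ⊢
  constructor <;> linarith

/-- ★ **`3.0556 ≤ J₁⁽⁶⁾(2/3) ≤ 3.0557`** — the offset-coset sum `Σ (Q₁ + 2/3)⁻⁶` (box `40` kernel floor sum + crude tail `< 10⁻¹²`).
[this file · kind: proof] -/
theorem layerSum_one_six_mem : 3.0556 ≤ layerSum 1 6 (2 / 3) ∧ layerSum 1 6 (2 / 3) ≤ 3.0557 := by
  have h1 := boxFloorSum_sound_le (p := 2) (q := 3) (δ := 1) (by norm_num) (by norm_num) le_rfl
    1 40 6 (M := 10 ^ 18) (by norm_num)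
  have h1' := boxFloorSum_sound_ge (p := 2) (q := 3) (δ := 1) (by norm_num) (by norm_num) le_rfl
    (k := 1) 40 (n := 6) (by norm_num) (Or.inl (by norm_num)) (M := 10 ^ 18) (by norm_num)
  rw [boxFloorSum_6_1_1] at h1 h1'
  have lo := sum_box_le_layerSum (δ := 1) le_rfl (s := 2 / 3) (by norm_num) (n := 6) (by norm_num) 40
  have hi := layerSum_le_box_add_tail (δ := 1) le_rfl (s := 2 / 3) (by norm_num) (d := 5) (by norm_num) (R := 40)
    (by norm_num)
  norm_num at h1 h1' lo hi ⊢
  constructor <;> linarith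

end Summit.AtomisticToContinuum.Crystallization.Theorems.OverbindingBudgetAffineRunCutChiralityKernel
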